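import Literature.NumberTheory.GaloisCohomology.Howard2004.DualityDatumTateDualBridge
import HarnessLib

/-!
# Howard 2004, H.4: `Θ : Tw(T) → T^∨(1)` is bijective for a perfect datum read through a dualizing character

Topic `NumberTheory/GaloisCohomology/Howard2004` (sequel to `DualityDatumTateDualBridge`; theorems only — no definition, no
named fact, no instance, no `sorry`).

For Howard's H.4 datum `D` (a PERFECT symmetric `R`-bilinear `e : T × T → R(1)`, [arXiv:1202.6340 p. 7 L69–77]) and bridge
data `(λ : R → ℤ/p^k, exp : ℤ/p^k → μ_{p^k})`, the map `Θ = D.toTateDual λ exp : Tw(T) → T^∨(1) = Hom(T, μ_{p^k})`,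
`t ↦ (s ↦ exp λ e(s, t))`, is

* injective if `exp` is injective and `φ ↦ λ ∘ φ : Hom_R(T, R) → Hom(T, ℤ/p^k)` is injective (`toTateDual_injective`);
* surjective if `exp` is surjective and `φ ↦ λ ∘ φ` is surjective (`toTateDual_surjective`);
* hence **bijective** when `exp` is bijective and `λ` is DUALIZING for `T` — `Hom_R(T, R) ≅ Hom_ℤ(T, ℤ/p^k)` under
  `φ ↦ λ ∘ φ` (Howard §2.1: «`Hom_{S_𝔭}(N, 𝒟_𝔭(1)) ≅ Hom_{ℤ_p}(N, μ_{p^∞})`»; for the cell's level rings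
  `A_{m,k} = Λ/(T^m + p, p^k)` and the tail form this is the tree's `EisensteinCoeff.tailFormZModComp_bijective`) —
  `toTateDual_bijective`: the hypothesis `hΘ` of `DualityDatum.isSelfOrthogonalAt_of_unramified`.

BSD is not proved by any of this.

References: [Howard2004HeegnerKolyvagin] B. Howard, Compositio Math. 140 (2004), §1.3 H.4, §2.1 (arXiv:1202.6340 p. 7,
p. 13 L20–24); [MilneADT2006] I §2 (`M^D = Hom(M, μ)`).
-/

noncomputable section

open Function NumberField Field
open scoped ContRepresentation

namespace Literature.NumberTheory.GaloisCohomology.Howard2004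

open Literature.NumberTheory.GaloisRepresentations
open Literature.NumberTheory.GaloisRepresentations.DiscreteGaloisModule

variable {K : Type} [Field K] [NumberField K] {M : Type} [AddCommGroup M] [TopologicalSpace M]
  [DiscreteTopology M] {R : Type} [CommRing R] [Module R M] [TopologicalSpace R] [DiscreteTopology R]
  {p : ℕ} [Fact p.Prime] [Algebra ℤ_[p] R] {cd : ConjugationDatum K} {ρ : DiscreteGaloisModule K M}
  (D : DualityDatum p cd ρ R) {k : ℕ}
  (lam : R →+ ZMod (p ^ k))
  (hlam : ∀ (z : ℤ_[p]) (r : R), lam (algebraMap ℤ_[p] R z * r) = PadicInt.toZModPow k z * lam r)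
  (exp : ZMod (p ^ k) →+ MuCarrier K (p ^ k))
  (hexp : ∀ (g : absoluteGaloisGroup K) (x : ZMod (p ^ k)),
    exp (cyclotomicCharacterModPow K p k g * x) = mu K (p ^ k) g (exp x))

namespace DualityDatum

/-- **`Θ` is injective** when `exp` is injective and `λ ∘ (·)` is injective on `Hom_R(T, R)`: `Θ t = Θ t'` gives
`λ e(s, t) = λ e(s, t')` for all `s`, i.e. `λ ∘ e(t, ·) = λ ∘ e(t', ·)` (symmetry), so `e(t, ·) = e(t', ·)` and `t = t'`
(`e` perfect). [cite: Howard2004HeegnerKolyvagin, §1.3 H.4 and §2.1 (arXiv p. 13, L20–24)] -/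
theorem toTateDual_injective [Finite M] (hexpi : Injective exp)
    (hlami : Injective fun φ : M →ₗ[R] R => lam.comp φ.toAddMonoidHom) :
    Injective (D.toTateDual lam hlam exp hexp) := by
  intro t t' h
  have hs : ∀ s : M, lam (D.e s t) = lam (D.e s t') := fun s => by
    apply hexpi
    rw [← D.toTateDual_apply_apply lam hlam exp hexp t s, ← D.toTateDual_apply_apply lam hlam exp hexp t' s, h]
  have he : D.e t = D.e t' := by
    apply hlami
    refine AddMonoidHom.ext fun s => ?_
    change lam (D.e t s) = lam (D.e t' s)
    rw [D.symm t s, D.symm t' s, hs s]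
  exact D.perfect.1 he

/-- **`Θ` is surjective** when `exp` is bijective and every character `T → ℤ/p^k` is `λ ∘ φ` for an `R`-linear
`φ : T → R`: `φ = e(t, ·)` for some `t` (`e` perfect), and `Θ t = exp ∘ λ ∘ e(·, t) = exp ∘ λ ∘ φ`.
[cite: Howard2004HeegnerKolyvagin, §1.3 H.4 and §2.1 (arXiv p. 13, L20–24)] -/
theorem toTateDual_surjective [Finite M] (hexpb : Bijective exp)
    (hlams : Surjective fun φ : M →ₗ[R] R => lam.comp φ.toAddMonoidHom) :
    Surjective (D.toTateDual lam hlam exp hexp) := by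
  intro χ
  let E : ZMod (p ^ k) ≃+ MuCarrier K (p ^ k) := AddEquiv.ofBijective exp hexpb
  let χ' : M →+ ZMod (p ^ k) := E.symm.toAddMonoidHom.comp (show M →+ MuCarrier K (p ^ k) from χ)
  obtain ⟨φ, hφ⟩ := hlams χ'
  obtain ⟨t, ht⟩ := D.perfect.2 φ
  refine ⟨t, TateDual.ext fun s => ?_⟩
  have h1 : lam (φ s) = χ' s := by
    have := congrArg (fun ψ : M →+ ZMod (p ^ k) => ψ s) hφ
    simpa using this
  rw [D.toTateDual_apply_apply lam hlam exp hexp t s, D.symm s t, ht, h1]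
  exact E.apply_symm_apply (χ s)

/-- **`Θ : Tw(T) ⥲ T^∨(1)` is bijective** for a perfect datum, a bijective trivialisation `exp : ℤ/p^k ≅ μ_{p^k}` and a
DUALIZING character `λ` for `T` (`φ ↦ λ ∘ φ : Hom_R(T, R) ≅ Hom(T, ℤ/p^k)`; Howard §2.1) — the hypothesis `hΘ` of
`DualityDatum.isSelfOrthogonalAt_of_unramified`. [cite: Howard2004HeegnerKolyvagin, §1.3 H.4 and §2.1 (arXiv p. 13, L20–24)]
[cite: MilneADT2006, Ch. I §2] -/
theorem toTateDual_bijective [Finite M] (hexpb : Bijective exp)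
    (hlamb : Bijective fun φ : M →ₗ[R] R => lam.comp φ.toAddMonoidHom) :
    Bijective (D.toTateDual lam hlam exp hexp) :=
  ⟨D.toTateDual_injective lam hlam exp hexp hexpb.1 hlamb.1, D.toTateDual_surjective lam hlam exp hexp hexpb hlamb.2⟩

end DualityDatum

end Literature.NumberTheory.GaloisCohomology.Howard2004
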